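import Literature.NumberTheory.EllipticCurves.Kato2004.MemberMultiplierInputs
import Literature.NumberTheory.EllipticCurves.ModularSymbolsLattice
import Literature.NumberTheory.EllipticCurves.PAdicLFunctionMinus
import Literature.NumberTheory.EllipticCurves.PAdicLFunctionProofs
import Literature.NumberTheory.EllipticCurves.PAdicLFunctionDistributionProofs
import HarnessLib

/-!
# Kato 2004 (Astérisque 295): the VALUE GUARD of the member-hull package is satisfiable — proved

Topic `NumberTheory/EllipticCurves`, sub-directory `Kato2004` (namespace = path).  THEOREMS ONLY (no `def … : Prop`,
net debt 0); a discharge, in the kernel, of the prose claim in the module docstring of `MemberHullValueInputs.lean`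
(«`R⁻ = cd(c−1)(d−1)·[a/A]⁻ ≠ 0` for a cusp `a/A` with `[a/A]⁻ ≠ 0`, which exists because the Manin symbols span and
`Ω⁻_f ≠ 0`») and in the docstring of `MemberHullInputs.lean` (the admissible choice `c = 1 + 6pA`, `d = 1 + 6pAN`,
`d′ = 1`).  Origin: ARM-P referee-reader sheet `pub/bsd-cited/sheets/D-AUDIT-r02-Q51-ADDENDUM-3.md` (kernel K50, P4/P5).

## Contents

* `exists_ratMinusSymbol_ne_zero` — a normalised newform `f ∈ S₂(Γ₀(N))` with rational coefficients has a cusp `r` with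
  non-zero rational minus symbol `[r]⁻_f ≠ 0` (Manin–Drinfeld: some period of `f` has non-zero imaginary part —
  `exists_im_cuspSymbol_ne_zero` — and `[r]⁻_f · Ω⁻_f · i = ({∞,r} − {∞,−r})/2`, `ratMinusSymbol_mul_minusPeriod_mul_I`).
* `valueGuard_satisfiable` — for every such `f`, every prime `p` and level `N ≠ 0` there is an ADMISSIBLE datum
  `(c, d, a, A)` of Kato's Example 13.3 (`A ≥ 1`, `(c, 6pA) = 1`, `(d, 6pN) = 1`) together with `d′` satisfying the value
  guard of `Kato2004.exists_memberHullValueInputs`: `(cd, A) = 1`, `dd′ ≡ 1 (A)` and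
  `cuspFactor f true 1 c d a A d′ ≠ 0` — namely Kato's own choice `c = 1 + 6pA`, `d = 1 + 6pAN`, `d′ = 1` at a cusp `a/A`
  with `[a/A]⁻_f ≠ 0`, for which the four cusps `a/A, ac/A, ad′/A, acd′/A` agree modulo `ℤ` and
  `R⁻ = cd(c−1)(d−1)·[a/A]⁻_f`.
* `ratCuspFactor_true_one_eq_zero`, `cuspFactor_true_one_eq_zero` — at `A = 1` Kato's four-cusp MINUS factor vanishes
  identically (`[n]⁻ = [0]⁻ = 0`): the datum `A = 1` can never carry the guard (all even-character values of the
  `a(1)`-classes vanish in the modular-symbol dictionary of `ZetaBody`'s value law (C5)).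

Nothing here is an input of BSD: these are elementary facts about modular symbols (Manin 1972 / Mazur–Tate–Teitelbaum
1986 §I.8, all TREE THEOREMS here) and integer arithmetic, recorded so that the guard displayed in
`exists_memberHullValueInputs` is citable BY NAME as consistent.  `Summits/` files may use `valueGuard_satisfiable` to
turn «for every admissible guarded datum …» statements into «there is one …» statements without prose.

## References

* K. Kato, *p-adic Hodge theory and values of zeta functions of modular forms*, Astérisque 295 (2004), Ex. 13.3 (p. 225:
  the guards `(c, 6pA) = (d, 6pN) = 1`), Lemma 13.10 (1) (p. 230: the four cusps `a/A, ac/A, “a/d”, “ac/d”`), Thm. 6.6 (1)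
  (p. 163), 13.9 (p. 229: «Fix … such that δ(f, j₁, α₁)⁺ ≠ 0»). [Kato2004Asterisque]
* B. Mazur, J. Tate, J. Teitelbaum, Invent. Math. 84 (1986), §I.8 (the symbols `[a/m]^±`). [MazurTateTeitelbaum1986Invent]
* J. E. Cremona, *Algorithms for modular elliptic curves* (1997), §2.8 (periods; `Ω⁻`). [CremonaAlgorithms1997]
* Tree: `MemberMultiplierInputs.lean` (`ratCuspFactor`, `cuspFactor_one_eq_ratCuspFactor`), `EulerSystemValues.lean`
  (`cuspFactor`), `ModularSymbolsLattice.lean` (`exists_im_cuspSymbol_ne_zero`, `IsNewform0.ne_zero`),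
  `PAdicLFunctionMinus.lean` (`ratMinusSymbol`, `ratMinusSymbol_add_intCast`, `ratMinusSymbol_zero`,
  `ratMinusSymbol_mul_minusPeriod_mul_I`), `PAdicLFunctionDistributionProofs.lean` (`minusSymbol_eq_im_mul_I_holds`).
-/

noncomputable section

open scoped MatrixGroups
open CongruenceSubgroup
open Literature.NumberTheory.EllipticCurves Literature.NumberTheory.EllipticCurves.ModularForms
open Literature.NumberTheory.EllipticCurves.Kato2004.EulerSystemValues

namespace Literature.NumberTheory.EllipticCurves.Kato2004

section MinusSymbol

variable {N : ℕ} [NeZero N] (f : CuspForm (Gamma0 N) 2)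

/-- **A rational newform has a cusp with non-zero rational minus symbol**: for a normalised newform
`f ∈ S₂(Γ₀(N))` with `K_f = ℚ` there is `r ∈ ℚ` with `[r]⁻_f ≠ 0`.  Proof: some period `{∞, γ∞}_f` has non-zero
imaginary part (`exists_im_cuspSymbol_ne_zero`, Manin–Drinfeld / Eichler–Shimura: `Ω⁻_f` exists), that period is
`{∞, r}_f` for `r = γ∞`, `({∞,r} − {∞,−r})/2 = i·Im{∞,r}` for real coefficients, and `[r]⁻_f·Ω⁻_f·i` equals it.
[cite: MazurTateTeitelbaum1986Invent, §I.8] -/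
theorem exists_ratMinusSymbol_ne_zero (hf : IsNewform0 f) (hQ : coeffField f = ⊥) :
    ∃ r : ℚ, ratMinusSymbol f r ≠ 0 := by
  obtain ⟨γ, hγ⟩ := exists_im_cuspSymbol_ne_zero f hf.ne_zero
  by_cases hc : (γ : SL(2, ℤ)) 1 0 = 0
  · exact absurd (by simp [cuspSymbol, hc]) hγ
  · have hms : cuspSymbol f γ =
        modularSymbol f ((((γ : SL(2, ℤ)) 0 0 : ℤ) : ℚ) / (((γ : SL(2, ℤ)) 1 0 : ℤ) : ℚ)) := by
      simp [cuspSymbol, hc]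
    refine ⟨(((γ : SL(2, ℤ)) 0 0 : ℤ) : ℚ) / (((γ : SL(2, ℤ)) 1 0 : ℤ) : ℚ), fun h0 => hγ ?_⟩
    set r : ℚ := (((γ : SL(2, ℤ)) 0 0 : ℤ) : ℚ) / (((γ : SL(2, ℤ)) 1 0 : ℤ) : ℚ)
    have hreal : ∀ n, (cuspCoeff f n).im = 0 := cuspCoeff_im_eq_zero_of_coeffField_eq_bot hQ
    have hmin : minusSymbol f r = ((modularSymbol f r).im : ℂ) * Complex.I :=
      minusSymbol_eq_im_mul_I_holds f hreal r
    have hprod := ratMinusSymbol_mul_minusPeriod_mul_I f hf hQ r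
    rw [h0, Rat.cast_zero, zero_mul, zero_mul] at hprod
    have him : ((modularSymbol f r).im : ℂ) * Complex.I = 0 := by rw [← hmin, ← hprod]
    have him' : (modularSymbol f r).im = 0 := by
      rcases mul_eq_zero.mp him with h | h
      · exact_mod_cast h
      · exact absurd h Complex.I_ne_zero
    rw [hms]; exact him'

/-- **Kato's admissible choice satisfies the value guard of `exists_memberHullValueInputs`.**  For a normalised
newform `f ∈ S₂(Γ₀(N))` with rational coefficients (`N ≠ 0`) and any prime `p`: there are `c, d, a ∈ ℤ`, `A ≥ 1`,
`d′ ∈ ℤ` with `(c, 6pA) = 1`, `(d, 6pN) = 1` (Ex. 13.3), `(cd, A) = 1`, `d·d′ ≡ 1 (mod A)` and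
`cuspFactor f true 1 c d a A d′ ≠ 0` — take a cusp `a/A` with `[a/A]⁻_f ≠ 0` (`exists_ratMinusSymbol_ne_zero`),
`c = 1 + 6pA`, `d = 1 + 6pAN`, `d′ = 1`; then the four cusps `a/A, ac/A, ad′/A, acd′/A` of Lemma 13.10 (1) differ by
integers, so `R⁻ = c²d²[a/A]⁻ − cd²[ac/A]⁻ − c²d[ad′/A]⁻ + cd[acd′/A]⁻ = cd(c−1)(d−1)·[a/A]⁻ ≠ 0`.
[cite: Kato2004Asterisque, Ex. 13.3 (p. 225) and Lemma 13.10 (1) (p. 230)] -/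
theorem valueGuard_satisfiable (hf : IsNewform0 f) (hQ : coeffField f = ⊥) (p : ℕ) [hp : Fact p.Prime] :
    ∃ (c d a : ℤ) (A : ℕ) (d' : ℤ), 0 < A ∧ Int.gcd c (6 * p * A) = 1 ∧ Int.gcd d (6 * p * N) = 1 ∧
      Int.gcd (c * d) A = 1 ∧ d * d' ≡ 1 [ZMOD (A : ℤ)] ∧
      cuspFactor f true (fun _ ↦ (1 : ℂ)) c d a A d' ≠ 0 := by
  obtain ⟨r, hr⟩ := exists_ratMinusSymbol_ne_zero f hf hQ
  obtain ⟨c, hc⟩ : ∃ c : ℤ, c = 1 + 6 * p * r.den := ⟨_, rfl⟩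
  obtain ⟨d, hd⟩ : ∃ d : ℤ, d = 1 + 6 * p * r.den * N := ⟨_, rfl⟩
  refine ⟨c, d, r.num, r.den, 1, r.den_pos, ?_, ?_, ?_, ?_, ?_⟩
  · rw [← Int.isCoprime_iff_gcd_eq_one]
    exact ⟨1, -1, by rw [hc]; ring⟩
  · rw [← Int.isCoprime_iff_gcd_eq_one]
    exact ⟨1, -(r.den : ℤ), by rw [hd]; ring⟩
  · rw [← Int.isCoprime_iff_gcd_eq_one]
    exact ⟨1, -(6 * p + 6 * p * N + 36 * p * p * r.den * N), by rw [hc, hd]; ring⟩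
  · rw [Int.modEq_iff_dvd]
    exact ⟨-(6 * p * N), by rw [hd]; ring⟩
  · rw [cuspFactor_one_eq_ratCuspFactor]
    have hrA : ((r.num : ℚ) / ((r.den : ℕ) : ℚ)) = r := r.num_div_den
    have hmul : r * ((r.den : ℕ) : ℚ) = (r.num : ℚ) := r.mul_den_eq_num
    have h2 : ((r.num : ℚ) * (c : ℚ)) / ((r.den : ℕ) : ℚ) = r + ((6 * p * r.num : ℤ) : ℚ) := by
      have e : ((r.num : ℚ) * (c : ℚ)) / ((r.den : ℕ) : ℚ) =
          ((r.num : ℚ) / ((r.den : ℕ) : ℚ)) * (c : ℚ) := by ring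
      rw [e, hrA, hc]; push_cast; rw [← hmul]; ring
    have h3 : ((r.num : ℚ) * ((1 : ℤ) : ℚ)) / ((r.den : ℕ) : ℚ) = r := by
      rw [Int.cast_one, mul_one]; exact hrA
    have h4 : ((r.num : ℚ) * (c : ℚ) * ((1 : ℤ) : ℚ)) / ((r.den : ℕ) : ℚ) =
        r + ((6 * p * r.num : ℤ) : ℚ) := by
      rw [Int.cast_one, mul_one]; exact h2
    have hRm : ratCuspFactor f true c d r.num r.den 1 =
        (c : ℚ) * (d : ℚ) * ((c : ℚ) - 1) * ((d : ℚ) - 1) * ratMinusSymbol f r := by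
      have e : ratCuspFactor f true c d r.num r.den 1 =
        ((c : ℚ) ^ 2 * (d : ℚ) ^ 2) * ratMinusSymbol f ((r.num : ℚ) / (r.den : ℕ))
          - ((c : ℚ) * (d : ℚ) ^ 2) * ratMinusSymbol f ((r.num * c : ℚ) / (r.den : ℕ))
          - ((c : ℚ) ^ 2 * (d : ℚ)) * ratMinusSymbol f ((r.num * (1 : ℤ) : ℚ) / (r.den : ℕ))
          + ((c : ℚ) * (d : ℚ)) * ratMinusSymbol f ((r.num * c * (1 : ℤ) : ℚ) / (r.den : ℕ)) := rfl
      rw [e, h2, h3, h4, hrA, ratMinusSymbol_add_intCast]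
      ring
    have hpq : (0 : ℚ) < p := by exact_mod_cast hp.out.pos
    have hdq : (0 : ℚ) < ((r.den : ℕ) : ℚ) := by exact_mod_cast r.den_pos
    have hNq : (0 : ℚ) < (N : ℚ) := by exact_mod_cast Nat.pos_of_ne_zero (NeZero.ne N)
    have hcq : (c : ℚ) = 1 + 6 * (p : ℚ) * ((r.den : ℕ) : ℚ) := by rw [hc]; push_cast; ring
    have hdq' : (d : ℚ) = 1 + 6 * (p : ℚ) * ((r.den : ℕ) : ℚ) * (N : ℚ) := by rw [hd]; push_cast; ring
    have hne : (c : ℚ) * (d : ℚ) * ((c : ℚ) - 1) * ((d : ℚ) - 1) * ratMinusSymbol f r ≠ 0 := by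
      have e1 : (c : ℚ) ≠ 0 := by rw [hcq]; positivity
      have e2 : (d : ℚ) ≠ 0 := by rw [hdq']; positivity
      have e3 : (c : ℚ) - 1 ≠ 0 := by
        rw [hcq]
        have : (1 : ℚ) + 6 * (p : ℚ) * ((r.den : ℕ) : ℚ) - 1 = 6 * (p : ℚ) * ((r.den : ℕ) : ℚ) := by ring
        rw [this]; positivity
      have e4 : (d : ℚ) - 1 ≠ 0 := by
        rw [hdq']
        have : (1 : ℚ) + 6 * (p : ℚ) * ((r.den : ℕ) : ℚ) * (N : ℚ) - 1 =
            6 * (p : ℚ) * ((r.den : ℕ) : ℚ) * (N : ℚ) := by ring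
        rw [this]; positivity
      exact mul_ne_zero (mul_ne_zero (mul_ne_zero (mul_ne_zero e1 e2) e3) e4) hr
    rw [hRm]; exact_mod_cast hne

/-- **The `A = 1` road is closed for the value guard**: for every `(c, d, a, d′)` the rational four-cusp MINUS factor
at `A = 1` vanishes, `ratCuspFactor f true c d a 1 d′ = 0` — every cusp `n/1` is `≡ 0 (mod ℤ)` and `[0]⁻_f = 0`
(`ratMinusSymbol_add_intCast`, `ratMinusSymbol_zero`).  (In the dictionary of `ZetaBody`'s value law this is «all
even-character values of the `a(1)`-classes vanish».) [cite: MazurTateTeitelbaum1986Invent, §I.8] -/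
theorem ratCuspFactor_true_one_eq_zero (c d a d' : ℤ) : ratCuspFactor f true c d a 1 d' = 0 := by
  have e : ratCuspFactor f true c d a 1 d' =
    ((c : ℚ) ^ 2 * (d : ℚ) ^ 2) * ratMinusSymbol f ((a : ℚ) / (1 : ℕ))
      - ((c : ℚ) * (d : ℚ) ^ 2) * ratMinusSymbol f ((a * c : ℚ) / (1 : ℕ))
      - ((c : ℚ) ^ 2 * (d : ℚ)) * ratMinusSymbol f ((a * d' : ℚ) / (1 : ℕ))
      + ((c : ℚ) * (d : ℚ)) * ratMinusSymbol f ((a * c * d' : ℚ) / (1 : ℕ)) := rfl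
  have key : ∀ q : ℚ, (∃ n : ℤ, (n : ℚ) = q) → ratMinusSymbol f (q / ((1 : ℕ) : ℚ)) = 0 := by
    rintro q ⟨n, rfl⟩
    have h := ratMinusSymbol_add_intCast f 0 n
    rw [zero_add] at h
    rw [Nat.cast_one, div_one, h, ratMinusSymbol_zero]
  rw [e, key _ ⟨a, rfl⟩, key _ ⟨a * c, Int.cast_mul a c⟩, key _ ⟨a * d', Int.cast_mul a d'⟩,
    key _ ⟨a * c * d', by rw [Int.cast_mul, Int.cast_mul]⟩]
  ring

/-- **Kato's complex four-cusp factor at the trivial character vanishes at `A = 1`**: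
`cuspFactor f true 1 c d a 1 d′ = 0` (cast of `ratCuspFactor_true_one_eq_zero` through
`cuspFactor_one_eq_ratCuspFactor`). [cite: Kato2004Asterisque, Thm. 6.6 (1) (p. 163)] -/
theorem cuspFactor_true_one_eq_zero (c d a d' : ℤ) :
    cuspFactor f true (fun _ ↦ (1 : ℂ)) c d a 1 d' = 0 := by
  rw [cuspFactor_one_eq_ratCuspFactor, ratCuspFactor_true_one_eq_zero, Rat.cast_zero]

end MinusSymbol

end Literature.NumberTheory.EllipticCurves.Kato2004

end
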